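import Literature.AlgebraicGeometry.HodgeTheory.ComplexPointsSemialgebraicCharts
import Literature.ModelTheory.ExponentialFields.SemialgebraicAtlasModel
import HarnessLib

/-!
# A compact neighbourhood of a Zariski-closed subset of `X(ℂ)` is homeomorphic to a semialgebraic set

Topic `Literature/AlgebraicGeometry/HodgeTheory`; sequel of `ComplexPointsSemialgebraicCharts`
(one affine chart of `X(ℂ)` as a real algebraic set) and of the abstract
`ModelTheory/ExponentialFields/SemialgebraicAtlasModel` (compact semialgebraic models from a
finite compatible atlas). For a `ℂ`-scheme `X` locally of finite type and SEPARATED: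

* `AffineChart.toChart` — an affine chart is a semialgebraic chart of `X(ℂ)` in the sense of
  `SemialgAtlas.Chart` (closed embedding `U(ℂ) → ℝ²ⁿ` onto a real algebraic set);
* `AffineChart.compatible` — **any two affine charts are semialgebraically compatible**: `U ∩ U'`
  is quasi-compact (`X` separated, Mathlib `QuasiSeparatedSpace`), hence covered by finitely many
  opens on which the coordinates of `U'` are fractions `g / fᵉ` of regular functions on `U`
  (`AffineChart.exists_fraction_eval`, Serre GAGA §2 n°5), whose real and imaginary parts are
  quotients of real polynomials in the real coordinates of `U`; so the transition map is
  semialgebraic (piecewise `isSemialgebraicFunOn_aeval_div_aeval`);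
* `exists_semialgebraic_model` — **theorem**: for `Z ⊆ X` Zariski-closed and `K ⊆ X(ℂ)` compact
  there are a compact `T ⊆ X(ℂ)` with `K ⊆ interior T`, and `Ψ : X(ℂ) → ℝᴺ` continuous and
  injective on `T` (so `T ≅ Ψ(T)`), with `Ψ(T)` and `Ψ(T ∩ Z(ℂ))` semialgebraic
  (`SemialgAtlas.exists_model` for finitely many unit balls in affine charts covering `K`).

This is the classical fact that complex algebraic varieties are locally (indeed on compact
neighbourhoods of compact subsets) semialgebraic, the input of Łojasiewicz's triangulation of
`(X(ℂ), Z(ℂ))` (Łojasiewicz 1964; Hironaka 1975; Bochnak–Coste–Roy §9.2) — here for the special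
fibre of a proper family (`SpecialisationMapRetraction.exists_homotopyEquiv_fiberToTube`).
Everything is proved; no named fact is introduced.

## References

* J.-P. Serre, *Géométrie algébrique et géométrie analytique*, Ann. Inst. Fourier 6 (1956), §2
  n°5 Lemme 1. [SerreGAGA1956]
* J. Bochnak, M. Coste, M.-F. Roy, *Real Algebraic Geometry* (1998), §2.2, §3.4, Thm. 9.2.1.
  [BochnakCosteRoy1998]
* S. Łojasiewicz, *Triangulation of semi-analytic sets*, Ann. Sc. Norm. Sup. Pisa 18 (1964),
  449–474.
-/

noncomputable section

open CategoryTheory AlgebraicGeometry Set MvPolynomial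
open _root_.Topology _root_.Filter
open Literature.AlgebraicGeometry.Motives
open Literature.AlgebraicGeometry.Motives.AlgPoints (evalOrZero evalOrZero_of_mem)
open Literature.ModelTheory.ExponentialFields (IsSemialgebraic isSemialgebraic_empty)
open Literature.ModelTheory.ExponentialFields.SemialgAtlas
open Literature.NumberTheory.Transcendental

namespace Literature.AlgebraicGeometry.HodgeTheory

namespace SemialgModel

/-! ### Realification is a homeomorphism `ℂⁿ ≃ ℝ²ⁿ` -/

/-- `ℂⁿ ≃ₜ ℝ²ⁿ`, `z ↦ (Re z, Im z)`. [folklore] -/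
def realifyHomeomorph (n : ℕ) : (Fin n → ℂ) ≃ₜ (Fin (n + n) → ℝ) where
  toFun := ProjSemialg.realify
  invFun := ProjSemialg.complexify
  left_inv := ProjSemialg.complexify_realify
  right_inv := ProjSemialg.realify_complexify
  continuous_toFun := by
    refine continuous_pi fun j => ?_
    refine Fin.addCases (fun i => ?_) (fun i => ?_) j
    · simp only [ProjSemialg.realify_castAdd]
      exact Complex.continuous_re.comp (continuous_apply i)
    · simp only [ProjSemialg.realify_natAdd]
      exact Complex.continuous_im.comp (continuous_apply i)
  continuous_invFun := by
    have : (ProjSemialg.complexify : (Fin (n + n) → ℝ) → Fin n → ℂ) =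
        fun x i => (x (Fin.castAdd n i) : ℂ) + (x (Fin.natAdd n i) : ℂ) * Complex.I :=
      funext fun x => funext fun i => ProjSemialg.complexify_apply_eq x i
    rw [this]
    fun_prop

variable {X : SchemeOver ℂ}

namespace AffineChart

/-! ### Affine charts as semialgebraic charts -/

/-- **An affine chart is a semialgebraic chart of `X(ℂ)`.** [cite: SerreGAGA1956, §2 n°5 Lemme 1] -/
def toChart (C : AffineChart X) : Chart (ComplexPoints X) where
  dom := C.dom
  isOpen_dom := C.isOpen_dom
  m := C.n + C.n
  φ := C.coordR
  isClosedEmbedding_restrict :=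
    (realifyHomeomorph C.n).isClosedEmbedding.comp C.isClosedEmbedding_restrict_coord
  isSemialgebraic_image := C.isSemialgebraic_image_coordR

/-- The domain of the associated chart. [folklore] -/
@[simp] theorem toChart_dom (C : AffineChart X) : C.toChart.dom = C.dom := rfl
/-- The coordinates of the associated chart. [folklore] -/
@[simp] theorem toChart_φ (C : AffineChart X) : C.toChart.φ = C.coordR := rfl
/-- The number of real coordinates of the associated chart. [folklore] -/
@[simp] theorem toChart_m (C : AffineChart X) : C.toChart.m = C.n + C.n := rfl

variable (C C' : AffineChart X)

/-- Real part of the `j`-th complex coordinate = the `castAdd j`-th real coordinate. [folklore] -/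
theorem coordR_castAdd (Q : ComplexPoints X) (j : Fin C.n) :
    C.coordR Q (Fin.castAdd C.n j) = (C.coord Q j).re :=
  ProjSemialg.realify_castAdd _ _

/-- Imaginary part of the `j`-th complex coordinate = the `natAdd j`-th real coordinate. [folklore] -/
theorem coordR_natAdd (Q : ComplexPoints X) (j : Fin C.n) :
    C.coordR Q (Fin.natAdd C.n j) = (C.coord Q j).im :=
  ProjSemialg.realify_natAdd _ _

/-- The coordinate image of the overlap `U(ℂ) ∩ U'(ℂ)` is semialgebraic (complement in `c_U(U(ℂ))`
of the image of the Zariski-closed `U ∖ U'`). [cite: BochnakCosteRoy1998, §3.4] -/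
theorem isSemialgebraic_image_coordR_inter_dom [LocallyOfFiniteType X.hom] :
    IsSemialgebraic ℝ (C.coordR '' (C.dom ∩ C'.dom)) := by
  have hZ : IsClosed ((C'.U : Set X.left)ᶜ) := C'.U.isOpen.isClosed_compl
  have h1 := C.isSemialgebraic_image_coordR_inter hZ
  have heq : C.coordR '' (C.dom ∩ C'.dom) =
      C.coordR '' C.dom \ C.coordR '' (C.dom ∩ {Q | Q.pt ∈ (C'.U : Set X.left)ᶜ}) := by
    ext w
    constructor
    · rintro ⟨Q, ⟨hQ, hQ'⟩, rfl⟩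
      refine ⟨⟨Q, hQ, rfl⟩, ?_⟩
      rintro ⟨Q₁, ⟨hQ₁, hQ₁'⟩, h⟩
      have : Q₁ = Q := C.coordR_injOn hQ₁ hQ h
      rw [this] at hQ₁'
      exact hQ₁' hQ'
    · rintro ⟨⟨Q, hQ, rfl⟩, hnot⟩
      refine ⟨Q, ⟨hQ, ?_⟩, rfl⟩
      by_contra hQ'
      exact hnot ⟨Q, ⟨hQ, hQ'⟩, rfl⟩
  rw [heq]
  exact C.isSemialgebraic_image_coordR.diff h1

/-! ### The transition functions are semialgebraic -/

section Transition

omit C C' in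
/-- `X` separated over `ℂ` is a quasi-separated topological space. [folklore] -/
theorem quasiSeparatedSpace [IsSeparated X.hom] : QuasiSeparatedSpace X.left :=
  quasiSeparatedSpace_of_quasiSeparated X.hom

omit C' in
/-- Evaluation at a point is multiplicative: `(sᵉ)(Q) = s(Q)ᵉ`. [folklore] -/
theorem eval_pow (Q : ComplexPoints X) (hQ : Q.pt ∈ C.U) (s : Γ(X.left, C.U)) (n : ℕ) :
    Q.eval C.U hQ (s ^ n) = Q.eval C.U hQ s ^ n := by
  rw [← AlgPoints.evalRingHom_apply, map_pow, AlgPoints.evalRingHom_apply]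

/-- The inverse of the real coordinates on `c_U(U(ℂ))` (the inverse chart of `C.toChart`).
[folklore] -/
def inv [Nonempty (ComplexPoints X)] : (Fin (C.n + C.n) → ℝ) → ComplexPoints X :=
  Function.invFunOn C.coordR C.dom

omit C' in
/-- The inverse chart of the associated chart is `inv`. [folklore] -/
theorem toChart_inv [Nonempty (ComplexPoints X)] : C.toChart.inv = C.inv := rfl

omit C' in
/-- `inv (c_U Q) = Q` on `U(ℂ)`. [folklore] -/
theorem inv_apply [Nonempty (ComplexPoints X)] {Q : ComplexPoints X} (hQ : Q.pt ∈ C.U) :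
    C.inv (C.coordR Q) = Q :=
  C.coordR_injOn.leftInvOn_invFunOn hQ


/-- **Transition data on a finite cover of `U ∩ U'`.** There are finitely many points `l` and,
for each, regular functions `f_{l,j}, g_{l,j} ∈ Γ(X, U)` and exponents `e_{l,j}` (`j` running over
the coordinates of `U'`) such that: the opens `W_l = U ∩ U' ∩ ⋂ⱼ D(f_{l,j})` cover `U ∩ U'`, and on
the complex points of `W_l` every coordinate `x'_j` of `U'` equals `g_{l,j} / f_{l,j}^{e_{l,j}}`
with `f_{l,j} ≠ 0`. [cite: SerreGAGA1956, §2 n°5 Lemme 1] -/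
theorem exists_transition_cover [IsSeparated X.hom] :
    ∃ (L : Type) (_ : Fintype L) (f g : L → Fin C'.n → Γ(X.left, C.U)) (e : L → Fin C'.n → ℕ),
      (∀ x : X.left, x ∈ C.U → x ∈ C'.U → ∃ l, ∀ j, x ∈ X.left.basicOpen (f l j)) ∧
      ∀ (l : L) (j : Fin C'.n) (Q : ComplexPoints X) (hQ : Q.pt ∈ C.U) (hQ' : Q.pt ∈ C'.U),
        Q.pt ∈ X.left.basicOpen (f l j) →
          Q.eval C.U hQ (f l j) ≠ 0 ∧
            Q.eval C'.U hQ' (C'.x j) = Q.eval C.U hQ (g l j) / Q.eval C.U hQ (f l j) ^ e l j := by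
  classical
  haveI := quasiSeparatedSpace (X := X)
  -- pointwise data
  have hpt : ∀ x : ↥((C.U : Set X.left) ∩ C'.U), ∀ j : Fin C'.n,
      ∃ (f g : Γ(X.left, C.U)) (e : ℕ), x.1 ∈ X.left.basicOpen f ∧
        ∀ (Q : ComplexPoints X) (hQ : Q.pt ∈ C.U) (hQ' : Q.pt ∈ C'.U),
          Q.pt ∈ X.left.basicOpen f → Q.eval C.U hQ f ≠ 0 ∧
            Q.eval C'.U hQ' (C'.x j) = Q.eval C.U hQ g / Q.eval C.U hQ f ^ e := by
    intro x j
    obtain ⟨f, g, e, hle, hxf, h⟩ := C.exists_fraction_eval (C'.x j) x.2.1 x.2.2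
    refine ⟨f, g, e, hxf, fun Q hQ hQ' hQf => ?_⟩
    obtain ⟨h1, h2⟩ := h Q hQf
    exact ⟨h1, h2⟩
  choose f g e hxf hfrac using hpt
  -- the open cover of the compact `U ∩ U'`
  have hcpt : IsCompact ((C.U : Set X.left) ∩ C'.U) :=
    C.isAffineOpen.isCompact.inter_of_isOpen C'.isAffineOpen.isCompact C.U.isOpen C'.U.isOpen
  let W : ↥((C.U : Set X.left) ∩ C'.U) → Set X.left := fun x => ⋂ j, (X.left.basicOpen (f x j) : Set X.left)
  have hWo : ∀ x, IsOpen (W x) := fun x => isOpen_iInter_of_finite fun j => (X.left.basicOpen _).isOpen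
  have hWcov : (C.U : Set X.left) ∩ C'.U ⊆ ⋃ x, W x := fun y hy =>
    mem_iUnion.2 ⟨⟨y, hy⟩, mem_iInter.2 fun j => hxf ⟨y, hy⟩ j⟩
  obtain ⟨t, ht⟩ := hcpt.elim_finite_subcover W hWo hWcov
  refine ⟨↥t, inferInstance, fun l => f l.1, fun l => g l.1, fun l => e l.1, fun x hx hx' => ?_,
    fun l j Q hQ hQ' hQf => hfrac l.1 j Q hQ hQ' hQf⟩
  have := ht ⟨hx, hx'⟩
  simp only [mem_iUnion] at this
  obtain ⟨l, hl, hlx⟩ := this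
  exact ⟨⟨l, hl⟩, fun j => mem_iInter.1 hlx j⟩

/-- **The transition map between two affine charts is semialgebraic.**
[cite: BochnakCosteRoy1998, Prop. 2.2.6 and §3.4] -/
theorem isSemialgebraicMapOn_transition [LocallyOfFiniteType X.hom] [IsSeparated X.hom]
    [Nonempty (ComplexPoints X)] :
    IsSemialgebraicMapOn ℝ (C.coordR '' (C.dom ∩ C'.dom)) (C'.coordR ∘ C.inv) := by
  classical
  obtain ⟨L, _, f, g, e, hcov, hfrac⟩ := exists_transition_cover C C'
  set D : Set (Fin (C.n + C.n) → ℝ) := C.coordR '' (C.dom ∩ C'.dom) with hD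
  have hDs : IsSemialgebraic ℝ D := C.isSemialgebraic_image_coordR_inter_dom C'
  -- the inverse chart on `D`
  have hinv : ∀ w ∈ D, C.inv w ∈ C.dom ∧ C.inv w ∈ C'.dom ∧ C.coordR (C.inv w) = w := by
    rintro w ⟨Q, hQ, rfl⟩
    rw [C.inv_apply hQ.1]
    exact ⟨hQ.1, hQ.2, rfl⟩
  -- real polynomials for `|f|²`, `Re/Im g`, `Re/Im h`, `|h|²` with `h = f ^ e`
  choose Nf hNf using fun s : Γ(X.left, C.U) => C.exists_normSq_poly_eval s
  choose Pre Pim hP using fun s : Γ(X.left, C.U) => C.exists_re_im_poly_eval s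
  -- the pieces
  let Dl : L → Set (Fin (C.n + C.n) → ℝ) := fun l =>
    D ∩ ⋂ j ∈ (Finset.univ : Finset (Fin C'.n)), {w | aeval w (Nf (f l j)) ≠ 0}
  have hDl : ∀ l, IsSemialgebraic ℝ (Dl l) := fun l =>
    hDs.inter (Literature.ModelTheory.ExponentialFields.IsSemialgebraic.biInter Finset.univ _
      fun j _ => Literature.ModelTheory.ExponentialFields.isSemialgebraic_setOf_eval_ne_zero _)
  have hcover : D = ⋃ l ∈ (Finset.univ : Finset L), Dl l := by
    apply Subset.antisymm
    · intro w hw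
      obtain ⟨hd, hd', hw'⟩ := hinv w hw
      obtain ⟨l, hl⟩ := hcov _ hd hd'
      refine mem_iUnion₂.2 ⟨l, Finset.mem_univ l, hw, mem_iInter₂.2 fun j _ => ?_⟩
      have h1 := (hfrac l j _ hd hd' (hl j)).1
      show aeval w (Nf (f l j)) ≠ 0
      rw [← hw', ← hNf (f l j) _ hd]
      exact (Complex.normSq_pos.2 h1).ne'
    · exact iUnion₂_subset fun l _ => inter_subset_left
  -- on a piece, membership gives `f_{l,j} ≠ 0`
  have hmemDl : ∀ l, ∀ w ∈ Dl l, ∀ j, (C.inv w).pt ∈ X.left.basicOpen (f l j) := by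
    intro l w hw j
    obtain ⟨hd, -, hw'⟩ := hinv w hw.1
    have h := mem_iInter₂.1 hw.2 j (Finset.mem_univ j)
    simp only [mem_setOf_eq] at h
    rw [← hw', ← hNf (f l j) _ hd] at h
    rw [AlgPoints.pt_mem_basicOpen_iff _ hd]
    intro h0
    exact h (by rw [h0, map_zero])
  -- each real coordinate of `U'` is semialgebraic on `D`
  refine IsSemialgebraicMapOn.of_forall hDs fun k => ?_
  -- the complex coordinate `j` as a fraction on piece `l`: real and imaginary parts
  have key : ∀ j : Fin C'.n, IsSemialgebraicFunOn ℝ D (fun w => (C'.coord (C.inv w) j).re) ∧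
      IsSemialgebraicFunOn ℝ D (fun w => (C'.coord (C.inv w) j).im) := by
    intro j
    have hval : ∀ l, ∀ w ∈ Dl l,
        C'.coord (C.inv w) j =
          ((aeval w (Pre (g l j)) : ℂ) + (aeval w (Pim (g l j)) : ℂ) * Complex.I) /
            ((aeval w (Pre (f l j ^ e l j)) : ℂ) + (aeval w (Pim (f l j ^ e l j)) : ℂ) * Complex.I) := by
      intro l w hw
      obtain ⟨hd, hd', hw'⟩ := hinv w hw.1
      have hfr := (hfrac l j _ hd hd' (hmemDl l w hw j)).2
      have hg := hP (g l j) _ hd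
      have hh := hP (f l j ^ e l j) _ hd
      rw [hw'] at hg hh
      have e1 : C'.coord (C.inv w) j = (C.inv w).eval C'.U hd' (C'.x j) :=
        evalOrZero_of_mem _ hd'
      rw [e1, hfr, ← C.eval_pow]
      congr 1
      · exact Complex.ext (by simp [hg.1]) (by simp [hg.2])
      · exact Complex.ext (by simp [hh.1]) (by simp [hh.2])
    have hden : ∀ l, ∀ w ∈ Dl l, aeval w (Nf (f l j ^ e l j)) ≠ 0 := by
      intro l w hw
      obtain ⟨hd, hd', hw'⟩ := hinv w hw.1
      rw [← hw', ← hNf _ _ hd, C.eval_pow]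
      have h1 := (hfrac l j _ hd hd' (hmemDl l w hw j)).1
      exact (Complex.normSq_pos.2 (pow_ne_zero _ h1)).ne'
    have hnormSq : ∀ l, ∀ w ∈ Dl l,
        Complex.normSq ((aeval w (Pre (f l j ^ e l j)) : ℂ) + (aeval w (Pim (f l j ^ e l j)) : ℂ) * Complex.I) =
          aeval w (Nf (f l j ^ e l j)) := by
      intro l w hw
      obtain ⟨hd, hd', hw'⟩ := hinv w hw.1
      have hh := hP (f l j ^ e l j) _ hd
      have hn := hNf (f l j ^ e l j) _ hd
      rw [hw'] at hh hn
      rw [← hn]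
      congr 1
      exact Complex.ext (by simp [hh.1]) (by simp [hh.2])
    constructor
    · rw [hcover]
      refine isSemialgebraicFunOn_biUnion _ _ fun l _ => ?_
      refine (isSemialgebraicFunOn_aeval_div_aeval (hDl l)
        (Pre (g l j) * Pre (f l j ^ e l j) + Pim (g l j) * Pim (f l j ^ e l j)) (Nf (f l j ^ e l j))
        (hden l)).congr fun w hw => ?_
      rw [hval l w hw, Complex.div_re, hnormSq l w hw]
      simp only [map_add, map_mul, Complex.add_re, Complex.ofReal_re, Complex.mul_re, Complex.I_re,
        mul_zero, Complex.ofReal_im, Complex.I_im, mul_one, sub_self, add_zero, Complex.add_im,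
        Complex.mul_im, zero_add]
      ring
    · rw [hcover]
      refine isSemialgebraicFunOn_biUnion _ _ fun l _ => ?_
      refine (isSemialgebraicFunOn_aeval_div_aeval (hDl l)
        (Pim (g l j) * Pre (f l j ^ e l j) - Pre (g l j) * Pim (f l j ^ e l j)) (Nf (f l j ^ e l j))
        (hden l)).congr fun w hw => ?_
      rw [hval l w hw, Complex.div_im, hnormSq l w hw]
      simp only [map_sub, map_mul, Complex.add_re, Complex.ofReal_re, Complex.mul_re, Complex.I_re,
        mul_zero, Complex.ofReal_im, Complex.I_im, mul_one, sub_self, add_zero, Complex.add_im,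
        Complex.mul_im, zero_add]
      ring
  refine Fin.addCases (fun j => ?_) (fun j => ?_) k
  · refine (key j).1.congr fun w _ => ?_
    simp only [Function.comp_apply, C'.coordR_castAdd]
  · refine (key j).2.congr fun w _ => ?_
    simp only [Function.comp_apply, C'.coordR_natAdd]

/-- **Any two affine charts of `X(ℂ)` are semialgebraically compatible** (`X` locally of finite
type and separated over `ℂ`). [cite: BochnakCosteRoy1998, Prop. 2.2.6 and §3.4] -/
theorem compatible [LocallyOfFiniteType X.hom] [IsSeparated X.hom] :
    Chart.Compatible C.toChart C'.toChart := by
  cases isEmpty_or_nonempty (ComplexPoints X) with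
  | inl h => exact Chart.compatible_of_isEmpty _ _
  | inr h =>
    exact Chart.compatible_of_isSemialgebraicMapOn (C.isSemialgebraic_image_coordR_inter_dom C')
      (C.toChart_inv ▸ C.isSemialgebraicMapOn_transition C')

end Transition

end AffineChart

/-! ### The model -/

/-- **Compact neighbourhoods of compact subsets of `X(ℂ)` with semialgebraic models.** For `X`
locally of finite type and separated over `ℂ`, `Z ⊆ X` Zariski-closed and `K ⊆ X(ℂ)` compact, there
are a compact `T ⊇ K` with `K ⊆ interior T` and `Ψ : X(ℂ) → ℝᴺ`, continuous and injective on
`T`, with `Ψ(T)` and `Ψ(T ∩ Z(ℂ))` semialgebraic. [cite: BochnakCosteRoy1998, Prop. 2.2.7 and §3.4]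
[cite: SerreGAGA1956, §2 n°5 Lemme 1] -/
theorem exists_semialgebraic_model [LocallyOfFiniteType X.hom] [IsSeparated X.hom]
    {Z : Set X.left} (hZ : IsClosed Z) {K : Set (ComplexPoints X)} (hK : IsCompact K) :
    ∃ (T : Set (ComplexPoints X)) (N : ℕ) (Ψ : ComplexPoints X → Fin N → ℝ),
      IsCompact T ∧ K ⊆ interior T ∧ Continuous Ψ ∧ InjOn Ψ T ∧
        IsSemialgebraic ℝ (Ψ '' T) ∧ IsSemialgebraic ℝ (Ψ '' (T ∩ {Q | Q.pt ∈ Z})) := by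
  classical
  haveI : T2Space (ComplexPoints X) := ComplexPoints.t2Space_of_isSeparated X
  -- a chart and a unit ball at every point of `K`
  have hchart : ∀ Q : ComplexPoints X, ∃ C : AffineChart X, Q.pt ∈ C.U := fun Q => by
    obtain ⟨_, ⟨U, hU, rfl⟩, hQU, -⟩ :=
      X.left.isBasis_affineOpens.exists_subset_of_mem_open (Set.mem_univ Q.pt) isOpen_univ
    obtain ⟨C, hC⟩ := AffineChart.exists_eq_U (X := X) hU
    exact ⟨C, hC ▸ hQU⟩
  choose C hC using hchart
  let ball : ComplexPoints X → Ball (ComplexPoints X) := fun Q =>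
    ⟨(C Q).toChart, (C Q).coordR Q, 1, one_pos⟩
  have hball : ∀ Q, (ball Q).bump Q = 1 := fun Q => by
    rw [(ball Q).bump_of_mem (show Q ∈ (ball Q).c.dom from hC Q), Ball.bumpCoord]
    show max 0 (1 - sumSq ((C Q).coordR Q - (C Q).coordR Q)) = 1
    rw [sub_self, (sumSq_eq_zero_iff _).2 rfl]; norm_num
  -- a finite subfamily whose bumps cover `K`
  obtain ⟨t, ht⟩ := hK.elim_finite_subcover (fun Q : ComplexPoints X => {P | 0 < (ball Q).bump P})
    (fun Q => isOpen_lt continuous_const (ball Q).continuous_bump)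
    (fun Q _ => mem_iUnion.2 ⟨Q, by show 0 < (ball Q).bump Q; rw [hball Q]; exact one_pos⟩)
  set A := t.card
  let b : Fin A → Ball (ComplexPoints X) := fun a => ball (t.equivFin.symm a)
  have hcov : ∀ P ∈ K, ∃ a, 0 < (b a).bump P := fun P hP => by
    have := ht hP
    simp only [mem_iUnion, exists_prop] at this
    obtain ⟨Q, hQ, hQP⟩ := this
    refine ⟨t.equivFin ⟨Q, hQ⟩, ?_⟩
    show 0 < (ball (t.equivFin.symm (t.equivFin ⟨Q, hQ⟩))).bump P
    rw [Equiv.symm_apply_apply]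
    exact hQP
  -- a uniform `η > 0` below the best bump on `K`
  have hη : ∃ η > 0, ∀ P ∈ K, ∃ a, η < (b a).bump P := by
    by_cases hKe : K = ∅
    · exact ⟨1, one_pos, by simp [hKe]⟩
    obtain ⟨P₁, hP₁⟩ := Set.nonempty_iff_ne_empty.2 hKe
    have hA : 0 < A := by
      obtain ⟨a, -⟩ := hcov P₁ hP₁
      exact Fin.pos a
    let g : ComplexPoints X → ℝ := fun P => ∑ a, (b a).bump P
    have hg : Continuous g := continuous_finsetSum _ fun a _ => (b a).continuous_bump
    obtain ⟨P₀, hP₀, hmin⟩ := hK.exists_isMinOn ⟨P₁, hP₁⟩ hg.continuousOn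
    have hgpos : 0 < g P₀ := by
      obtain ⟨a, ha⟩ := hcov P₀ hP₀
      exact lt_of_lt_of_le ha (Finset.single_le_sum (f := fun a => (b a).bump P₀)
        (fun a _ => (b a).bump_nonneg P₀) (Finset.mem_univ a))
    refine ⟨g P₀ / (2 * A), by positivity, fun P hP => ?_⟩
    by_contra hnot
    simp only [not_exists, not_lt] at hnot
    have hle : g P ≤ A * (g P₀ / (2 * A)) := by
      calc g P = ∑ a, (b a).bump P := rfl
        _ ≤ ∑ _a : Fin A, g P₀ / (2 * A) := Finset.sum_le_sum fun a _ => hnot a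
        _ = A * (g P₀ / (2 * A)) := by simp
    have hge : g P₀ ≤ g P := hmin hP
    have hA' : (0 : ℝ) < A := by exact_mod_cast hA
    have : (A : ℝ) * (g P₀ / (2 * A)) = g P₀ / 2 := by field_simp
    rw [this] at hle
    linarith
  obtain ⟨η, hη0, hηK⟩ := hη
  -- the abstract model
  have hc : ∀ a a', Chart.Compatible (b a).c (b a').c := fun a a' =>
    AffineChart.compatible (C _) (C _)
  have hZ' : ∀ a, IsSemialgebraic ℝ ((b a).c.φ '' ((b a).c.dom ∩ {Q | Q.pt ∈ Z})) := fun a =>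
    (C _).isSemialgebraic_image_coordR_inter hZ
  obtain ⟨hT, -, -, hΨ, hinj, hS, hSZ⟩ :=
    Literature.ModelTheory.ExponentialFields.SemialgAtlas.exists_model b hc hZ' hη0
  refine ⟨tset b η, _, psi b, hT, fun P hP => ?_, hΨ, hinj, hS, hSZ⟩
  exact setOf_exists_lt_subset_interior b η (hηK P hP)

end SemialgModel

end Literature.AlgebraicGeometry.HodgeTheory

end
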